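import Summits.BirchSwinnertonDyer.BirchSwinnertonDyer.Theorems.AdditiveBranchIMCMultLowerCycLineBranchPackage
import HarnessLib

/-!
# Route `AdditiveBranchIMC` (rung K1), crux `MultLower` (item 19359), cell (M): the KERNEL (M) twin of
# gz's STEP B(2) — the first coefficient of Disegni's line function for a MULTIPLICATIVE twist model
# (`α = a_p(V) = ±1`, ONE-TERM Mazur–Tate–Teitelbaum branches), both parities

Cell `bsd-addord`, seat `bsd-addord-k1-c4` (gen 4). This is the first file of the kernel (M) twin of gz's
`DisegniLine*` chain (HOME/proof/PROOF-gz-kernel.md §4 «Mult rows: not in this kernel»; item 19592's text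
«the KERNEL (M) twin of gz's DisegniLine STEP A–C (α = a_p(V) = ±1) is unwritten»). THEOREMS ONLY (no
definition, no named fact, no `sorry`). gz's STEP A (`DisegniLineValues[Odd]`) and STEP B(1)
(`DisegniLinePointwise[Odd]`: `hasLineValueAt_twin_of_cycLineInterpolation[_odd]`) are α-GENERIC and are
imported, not re-derived (one-writer rule H2: gz owns `Additive/DisegniLine*`); only STEP B(2), which feeds
the Mazur–Tate–Teitelbaum interpolation THEOREM of the branch series, depends on the reduction type.

## What

For `V` MULTIPLICATIVE at the odd prime `p` with newform `g` (`IsNewformOf V g`), `a := a_p(V) = ±1`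
(`LFunction_eq_or_eq_neg_and_dvd_level_of_mult`), the one-term branches
`L^±_p(g, a, ω^{(p−1)/2}, T) = padicLFunction{Plus,Minus}BranchMult g a (p/2)` satisfy the three inputs
of gz's B(2) argument — boundedness, interpolation at EVERY character of `Γ` (no primitivity needed:
`hasSum_padicL{Plus,Minus}BranchMultCoeff_mul_pow`), constant term `a⁻¹·∑(a/p)[a/p]^±_g`
(`constantCoeff_padicLFunction{Plus,Minus}BranchMult_half`) — §1; hence (§2, §3):

* `coeff_one_cycLine_eq_mult` (`p ≡ 1 (mod 4)`): for `V, V′` multiplicative at `p` with the same `a_p`,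
  newforms `f, f′`, `a_n(f_E) = (n/p)a_n(f)`, `a_n(f′) = κ_K(n)a_n(f)`, `G` Disegni's line function for
  `(f_E, K, α = a_p(V))`: if `L⁺_p(f, a_p, ω^{(p−1)/2}, 0) = 0` then
  `[T¹]G = ι⁻¹(u·Car·Ω⁺_f·Ω⁺_{f′}) · ι([T¹]L⁺_p(f,…)) · ι(L⁺_p(f′,…)(0))`;
* `coeff_one_cycLine_eq_mult_odd` (`p ≡ 3 (mod 4)`): the same with minus symbols / minus branches and the
  constant `ι⁻¹(−u·Car·Ω⁻_f·Ω⁻_{f′})`.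

References: [Disegni2017] Thm. A, Lemma 10.2.1–10.2.2; [MazurTateTeitelbaum1986Invent] §I.10 (10.1) with
ε(p) = 0, §I.12–I.14; gz's `DisegniLineLeadingCoeff[Odd].lean` (p410677 / p416263).
-/

set_option autoImplicit false
set_option linter.dupNamespace false

noncomputable section

open scoped Classical MatrixGroups ModularForm NumberField

namespace Summit.BirchSwinnertonDyer.BirchSwinnertonDyer.Theorems.AdditiveBranchIMCMultLower

open CongruenceSubgroup WeierstrassCurve Literature.NumberTheory.EllipticCurves
  Literature.NumberTheory.EllipticCurves.ModularForms
  Literature.NumberTheory.EllipticCurves.Disegni2017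
  Literature.NumberTheory.EllipticCurves.Rank1Residual
  Summit.BirchSwinnertonDyer.Rank1Residual.Additive

/-! ### §2 STEP B(2) on (M), even branch (`p ≡ 1 (mod 4)`) -/

section LeadingCoeff

variable {p : ℕ} [hp : Fact p.Prime] (ι : PadicAlgCl p ≃+* ℂ)
  (K : Type) [Field K] [NumberField K] [IsGalois ℚ K]

/-- **STEP B(2), (M) twin — the first coefficient of Disegni's line function at a MULTIPLICATIVE twist
model.** `p ≡ 1 (mod 4)`; `V, V′` globally minimal, multiplicative at `p` with the same `a_p = ±1`,
newforms `f, f′`; `f_E` a newform with `a_n(f_E) = (n/p)a_n(f)`; `a_n(f′) = κ_K(n)a_n(f)`; `G` Disegni's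
line function for `(f_E, K, α = a_p(V))` (`CycLineInterpolation`); Artin formalism `hArt`. If
`L⁺_p(f, a_p, ω^{(p−1)/2}, 0) = 0`, then
`[T¹]G = ι⁻¹(u·Car·Ω⁺_f·Ω⁺_{f′}) · ι([T¹]L⁺_p(f, a_p, ω^{(p−1)/2}, T)) · ι(L⁺_p(f′, a_p, ω^{(p−1)/2}, 0))`.
gz's `coeff_one_cycLine_eq` with the two-term branches replaced by the one-term branches of §1.
[cite: Disegni2017, Theorem A, Lemma 10.2.1–10.2.2 (arXiv v3 PDF 7–8, 68)]
[cite: MazurTateTeitelbaum1986Invent, §I.10 (10.1), §I.13–I.14] -/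
theorem coeff_one_cycLine_eq_mult (hp4 : p % 4 = 1)
    (hArt : rankinSelbergEulerProductHecke_baseChangeDirichlet_eq)
    (h2 : Module.finrank ℚ K = 2) (κ : DirichletCharacter ℂ (NumberField.discr K).natAbs)
    (hκ : ∀ ℓ : ℕ, ℓ.Prime → ℓ ≠ 2 → κ ℓ = (jacobiSym (NumberField.discr K) ℓ : ℂ))
    (hκ2 : κ 2 = if NumberField.discr K % 8 = 1 then 1
        else if NumberField.discr K % 8 = 5 then -1 else 0)
    (hpd : Nat.Coprime p (NumberField.discr K).natAbs)
    (V V' : WeierstrassCurve ℚ) [V.IsElliptic] [V.IsGloballyMinimal] [V'.IsElliptic] [V'.IsGloballyMinimal]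
    (hV : Mult V p) (hV' : Mult V' p) (hap : V'.LFunction p = V.LFunction p)
    {N NE N' : ℕ} [NeZero N] [NeZero NE] [NeZero N'] {f : CuspForm (Gamma0 N) 2}
    {fE : CuspForm (Gamma0 NE) 2} {f' : CuspForm (Gamma0 N') 2}
    (hfV : IsNewformOf V f) (hfE : IsNewform0 fE) (hfV' : IsNewformOf V' f')
    (hE : ∀ n : ℕ, cuspCoeff fE n = (legendreSym p (n : ℤ) : ℂ) * cuspCoeff f n)
    (hfV'c : ∀ n : ℕ, cuspCoeff f' n = κ (n : ZMod (NumberField.discr K).natAbs) * cuspCoeff f n)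
    {Car : ℝ} {G : PowerSeries ℂ_[p]}
    (hG : CycLineInterpolation ι K fE ((V.LFunction p : ℤ) : ℚ_[p]) Car G)
    (hB0 : PowerSeries.constantCoeff
      (padicLFunctionPlusBranchMult f ((V.LFunction p : ℤ) : ℚ_[p]) (p / 2)) = 0) :
    PowerSeries.coeff 1 G =
      ((ι.symm ((splitLocalConstant p : ℂ) * (Car : ℂ) * (plusPeriod f : ℂ) * (plusPeriod f' : ℂ)) :
          PadicAlgCl p) : ℂ_[p]) *
        algebraMap ℚ_[p] ℂ_[p]
          (PowerSeries.coeff 1 (padicLFunctionPlusBranchMult f ((V.LFunction p : ℤ) : ℚ_[p]) (p / 2))) *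
        algebraMap ℚ_[p] ℂ_[p]
          (PowerSeries.constantCoeff
            (padicLFunctionPlusBranchMult f' ((V'.LFunction p : ℤ) : ℚ_[p]) (p / 2))) := by
  have hpP : p.Prime := hp.out
  have hp2 : p ≠ 2 := by intro h; rw [h] at hp4; norm_num at hp4
  have he1 : cyclotomicExponent p = 1 := cyclotomicExponent_eq_one p hp2
  set α : ℚ_[p] := ((V.LFunction p : ℤ) : ℚ_[p]) with hαdef
  have hα' : ((V'.LFunction p : ℤ) : ℚ_[p]) = α := by rw [hαdef, hap]
  set c : ℂ_[p] := ((ι.symm ((splitLocalConstant p : ℂ) * (Car : ℂ) * (plusPeriod f : ℂ) *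
    (plusPeriod f' : ℂ)) : PadicAlgCl p) : ℂ_[p]) with hc
  set B₁ := padicLFunctionPlusBranchMult f α (p / 2) with hB₁
  set B₂ := padicLFunctionPlusBranchMult f' ((V'.LFunction p : ℤ) : ℚ_[p]) (p / 2) with hB₂
  -- boundedness
  obtain ⟨CG, hCG⟩ := hG.isLineFunction.1
  obtain ⟨C₁, hC₁⟩ := exists_norm_coeff_padicLFunctionPlusBranchMult_le_of_mult V hV hfV (p / 2)
  obtain ⟨C₂, hC₂⟩ := exists_norm_coeff_padicLFunctionPlusBranchMult_le_of_mult V' hV' hfV' (p / 2)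
  have hM₁ : MemIwasawaRat p B₁ := memIwasawaRat_of_forall_norm_coeff_le hC₁
  have hM₂ : MemIwasawaRat p B₂ := memIwasawaRat_of_forall_norm_coeff_le hC₂
  -- the pointwise statement at a twin, for every typed `θ` mod `p^{m+1}` (STEP B(1), α-generic)
  have hpt : ∀ (m : ℕ) (hm : cyclotomicExponent p ≤ m + 1) (θ : DirichletCharacter ℂ (p ^ (m + 1))),
      θ.Even → (∃ j : ℕ, orderOf θ = p ^ j) → (θ.IsPrimitive ∨ m = 0) →
      HasLineValueAt G
        (((θ⁻¹.ringHomComp ι.symm.toRingHom).ringHomComp (algebraMap (PadicAlgCl p) ℂ_[p]))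
            (cyclotomicGenerator p : ZMod (p ^ (m + 1))) - 1)
        (c *
          (algebraMap ℚ_[p] ℂ_[p] (α⁻¹ ^ (m + 1)) *
            ∑ b : ZMod (p ^ (m + 1)),
              ((θ⁻¹.ringHomComp ι.symm.toRingHom).ringHomComp (algebraMap (PadicAlgCl p) ℂ_[p])) b *
                algebraMap ℚ_[p] ℂ_[p] (teichWeight p (p / 2)
                  (ZMod.castHom (pow_dvd_pow p hm) (ZMod (p ^ cyclotomicExponent p)) b)) *
                (ratPlusSymbol f ((b.val : ℚ) / ((p ^ (m + 1) : ℕ) : ℚ)) : ℂ_[p])) *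
          (algebraMap ℚ_[p] ℂ_[p] (α⁻¹ ^ (m + 1)) *
            ∑ b : ZMod (p ^ (m + 1)),
              ((θ⁻¹.ringHomComp ι.symm.toRingHom).ringHomComp (algebraMap (PadicAlgCl p) ℂ_[p])) b *
                algebraMap ℚ_[p] ℂ_[p] (teichWeight p (p / 2)
                  (ZMod.castHom (pow_dvd_pow p hm) (ZMod (p ^ cyclotomicExponent p)) b)) *
                (ratPlusSymbol f' ((b.val : ℚ) / ((p ^ (m + 1) : ℕ) : ℚ)) : ℂ_[p]))) :=
    fun m hm θ heven hord hprim ↦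
      hasLineValueAt_twin_of_cycLineInterpolation ι K hp4 hArt h2 κ hκ hκ2 hpd hfE hfV.1
        hfV.coeffField_eq_bot hfV'.1 hfV'.coeffField_eq_bot hE hfV'c hG hm θ heven hord hprim
  -- `T = 0`
  have hm0 : cyclotomicExponent p ≤ 0 + 1 := by rw [he1]
  have h0 : PowerSeries.constantCoeff G =
      c * algebraMap ℚ_[p] ℂ_[p] (PowerSeries.constantCoeff B₁) *
        algebraMap ℚ_[p] ℂ_[p] (PowerSeries.constantCoeff B₂) := by
    have h := hpt 0 hm0 1 (MulChar.one_apply isUnit_one.neg) ⟨0, by rw [orderOf_one, pow_zero]⟩ (Or.inr rfl)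
    rw [twin_one, MulChar.one_apply (isUnit_cyclotomicGenerator_cast p (0 + 1)), sub_self,
      sum_one_mul_teichWeight_mul_ratPlusSymbol_eq hp2 hm0 f,
      sum_one_mul_teichWeight_mul_ratPlusSymbol_eq hp2 hm0 f'] at h
    rw [(h.eq_constantCoeff).symm, hB₁, hB₂, constantCoeff_padicLFunctionPlusBranchMult_half_of_mult hp2 V hV hfV,
      constantCoeff_padicLFunctionPlusBranchMult_half_of_mult hp2 V' hV' hfV', hα', zero_add, pow_one,
      map_mul, map_mul]
  -- the characters of `Γ`
  have hchar : ∀ (m : ℕ) (χ : DirichletCharacter ℂ_[p] (p ^ (m + 2))), χ.IsPrimitive → χ.Even →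
      (∃ j : ℕ, orderOf χ = p ^ j) → ∀ v₁ v₂ : ℂ_[p],
        HasSum (fun i ↦ algebraMap ℚ_[p] ℂ_[p] (PowerSeries.coeff i B₁) *
          (χ (cyclotomicGenerator p : ZMod (p ^ (m + 2))) - 1) ^ i) v₁ →
        HasSum (fun i ↦ algebraMap ℚ_[p] ℂ_[p] (PowerSeries.coeff i B₂) *
          (χ (cyclotomicGenerator p : ZMod (p ^ (m + 2))) - 1) ^ i) v₂ →
        HasSum (fun i ↦ PowerSeries.coeff i G *
          (χ (cyclotomicGenerator p : ZMod (p ^ (m + 2))) - 1) ^ i) (c * v₁ * v₂) := by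
    intro m χ hχ heven hord v₁ v₂ hv₁ hv₂
    have hfin : IsOfFinOrder χ := by
      obtain ⟨j, hj⟩ := hord
      exact orderOf_pos_iff.mp (by rw [hj]; exact pow_pos hpP.pos j)
    obtain ⟨θ, hθ⟩ := exists_eq_twin_of_isOfFinOrder ι χ hfin
    subst hθ
    have hθeven : θ.Even := (twin_even_iff ι θ).mp heven
    have hθprim : θ.IsPrimitive := (twin_isPrimitive_iff ι θ).mp hχ
    have hθord : ∃ j : ℕ, orderOf θ = p ^ j := by rwa [orderOf_twin ι θ] at hord
    have hm : cyclotomicExponent p ≤ (m + 1) + 1 := by rw [he1]; omega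
    -- the MTT values at the twin (one-term interpolation theorem), identified with `v₁`, `v₂`
    have hT₁ := hasSum_coeff_padicLFunctionPlusBranchMult_mul_pow_of_mult V hV hfV (p / 2) (m := m + 1)
      hm _ heven hord
    have hT₂ := hasSum_coeff_padicLFunctionPlusBranchMult_mul_pow_of_mult V' hV' hfV' (p / 2) (m := m + 1)
      hm _ heven hord
    have e₁ := hv₁.unique hT₁
    have e₂ := hv₂.unique hT₂
    have h := hpt (m + 1) hm θ hθeven hθord (Or.inl hθprim)
    rw [e₁, e₂, hα']
    exact h
  have hmain := coeff_one_eq_of_forall_hasSum_of_bounded hCG hM₁ hM₂ c h0 hchar hB0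
  rw [hmain, hB₂]

end LeadingCoeff

/-! ### §3 STEP B⁻(2) on (M), odd branch (`p ≡ 3 (mod 4)`) -/

section LeadingCoeffOdd

variable {p : ℕ} [hp : Fact p.Prime] (ι : PadicAlgCl p ≃+* ℂ)
  (K : Type) [Field K] [NumberField K] [IsGalois ℚ K]

/-- **STEP B⁻(2), (M) twin — the first coefficient of Disegni's line function at a MULTIPLICATIVE twist
model, ODD branch.** `p ≡ 3 (mod 4)`; `V, V′` multiplicative at `p` with the same `a_p`, newforms `f, f′`,
`a_n(f_E) = (n/p)a_n(f)`, `a_n(f′) = κ_K(n)a_n(f)`, `G` Disegni's line function for `(f_E, K, α = a_p(V))`.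
If `L⁻_p(f, a_p, ω^{(p−1)/2}, 0) = 0` then
`[T¹]G = ι⁻¹(−u·Car·Ω⁻_f·Ω⁻_{f′}) · ι([T¹]L⁻_p(f, a_p, ω^{(p−1)/2}, T)) · ι(L⁻_p(f′, a_p, ω^{(p−1)/2}, 0))`.
gz's `coeff_one_cycLine_eq_odd` with the one-term minus branches of §1.
[cite: Disegni2017, Theorem A, Lemma 10.2.1–10.2.2 (arXiv v3 PDF 7–8, 68)]
[cite: MazurTateTeitelbaum1986Invent, §I.10 (10.1), §I.13–I.14] -/
theorem coeff_one_cycLine_eq_mult_odd (hp4 : p % 4 = 3)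
    (hArt : rankinSelbergEulerProductHecke_baseChangeDirichlet_eq)
    (h2 : Module.finrank ℚ K = 2) (κ : DirichletCharacter ℂ (NumberField.discr K).natAbs)
    (hκ : ∀ ℓ : ℕ, ℓ.Prime → ℓ ≠ 2 → κ ℓ = (jacobiSym (NumberField.discr K) ℓ : ℂ))
    (hκ2 : κ 2 = if NumberField.discr K % 8 = 1 then 1
        else if NumberField.discr K % 8 = 5 then -1 else 0)
    (hpd : Nat.Coprime p (NumberField.discr K).natAbs)
    (V V' : WeierstrassCurve ℚ) [V.IsElliptic] [V.IsGloballyMinimal] [V'.IsElliptic] [V'.IsGloballyMinimal]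
    (hV : Mult V p) (hV' : Mult V' p) (hap : V'.LFunction p = V.LFunction p)
    {N NE N' : ℕ} [NeZero N] [NeZero NE] [NeZero N'] {f : CuspForm (Gamma0 N) 2}
    {fE : CuspForm (Gamma0 NE) 2} {f' : CuspForm (Gamma0 N') 2}
    (hfV : IsNewformOf V f) (hfE : IsNewform0 fE) (hfV' : IsNewformOf V' f')
    (hE : ∀ n : ℕ, cuspCoeff fE n = (legendreSym p (n : ℤ) : ℂ) * cuspCoeff f n)
    (hfV'c : ∀ n : ℕ, cuspCoeff f' n = κ (n : ZMod (NumberField.discr K).natAbs) * cuspCoeff f n)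
    {Car : ℝ} {G : PowerSeries ℂ_[p]}
    (hG : CycLineInterpolation ι K fE ((V.LFunction p : ℤ) : ℚ_[p]) Car G)
    (hB0 : PowerSeries.constantCoeff
      (padicLFunctionMinusBranchMult f ((V.LFunction p : ℤ) : ℚ_[p]) (p / 2)) = 0) :
    PowerSeries.coeff 1 G =
      ((ι.symm (-(splitLocalConstant p : ℂ) * (Car : ℂ) * (minusPeriod f : ℂ) * (minusPeriod f' : ℂ)) :
          PadicAlgCl p) : ℂ_[p]) *
        algebraMap ℚ_[p] ℂ_[p]
          (PowerSeries.coeff 1 (padicLFunctionMinusBranchMult f ((V.LFunction p : ℤ) : ℚ_[p]) (p / 2))) *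
        algebraMap ℚ_[p] ℂ_[p]
          (PowerSeries.constantCoeff
            (padicLFunctionMinusBranchMult f' ((V'.LFunction p : ℤ) : ℚ_[p]) (p / 2))) := by
  have hpP : p.Prime := hp.out
  have hp2 : p ≠ 2 := by intro h; rw [h] at hp4; norm_num at hp4
  have he1 : cyclotomicExponent p = 1 := cyclotomicExponent_eq_one p hp2
  set α : ℚ_[p] := ((V.LFunction p : ℤ) : ℚ_[p]) with hαdef
  have hα' : ((V'.LFunction p : ℤ) : ℚ_[p]) = α := by rw [hαdef, hap]
  set c : ℂ_[p] := ((ι.symm (-(splitLocalConstant p : ℂ) * (Car : ℂ) * (minusPeriod f : ℂ) *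
    (minusPeriod f' : ℂ)) : PadicAlgCl p) : ℂ_[p]) with hc
  set B₁ := padicLFunctionMinusBranchMult f α (p / 2) with hB₁
  set B₂ := padicLFunctionMinusBranchMult f' ((V'.LFunction p : ℤ) : ℚ_[p]) (p / 2) with hB₂
  -- boundedness
  obtain ⟨CG, hCG⟩ := hG.isLineFunction.1
  obtain ⟨C₁, hC₁⟩ := exists_norm_coeff_padicLFunctionMinusBranchMult_le_of_mult V hV hfV (p / 2)
  obtain ⟨C₂, hC₂⟩ := exists_norm_coeff_padicLFunctionMinusBranchMult_le_of_mult V' hV' hfV' (p / 2)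
  have hM₁ : MemIwasawaRat p B₁ := memIwasawaRat_of_forall_norm_coeff_le hC₁
  have hM₂ : MemIwasawaRat p B₂ := memIwasawaRat_of_forall_norm_coeff_le hC₂
  -- the pointwise statement at a twin (STEP B⁻(1), α-generic)
  have hpt : ∀ (m : ℕ) (hm : cyclotomicExponent p ≤ m + 1) (θ : DirichletCharacter ℂ (p ^ (m + 1))),
      θ.Even → (∃ j : ℕ, orderOf θ = p ^ j) → (θ.IsPrimitive ∨ m = 0) →
      HasLineValueAt G
        (((θ⁻¹.ringHomComp ι.symm.toRingHom).ringHomComp (algebraMap (PadicAlgCl p) ℂ_[p]))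
            (cyclotomicGenerator p : ZMod (p ^ (m + 1))) - 1)
        (c *
          (algebraMap ℚ_[p] ℂ_[p] (α⁻¹ ^ (m + 1)) *
            ∑ b : ZMod (p ^ (m + 1)),
              ((θ⁻¹.ringHomComp ι.symm.toRingHom).ringHomComp (algebraMap (PadicAlgCl p) ℂ_[p])) b *
                algebraMap ℚ_[p] ℂ_[p] (teichWeight p (p / 2)
                  (ZMod.castHom (pow_dvd_pow p hm) (ZMod (p ^ cyclotomicExponent p)) b)) *
                (ratMinusSymbol f ((b.val : ℚ) / ((p ^ (m + 1) : ℕ) : ℚ)) : ℂ_[p])) *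
          (algebraMap ℚ_[p] ℂ_[p] (α⁻¹ ^ (m + 1)) *
            ∑ b : ZMod (p ^ (m + 1)),
              ((θ⁻¹.ringHomComp ι.symm.toRingHom).ringHomComp (algebraMap (PadicAlgCl p) ℂ_[p])) b *
                algebraMap ℚ_[p] ℂ_[p] (teichWeight p (p / 2)
                  (ZMod.castHom (pow_dvd_pow p hm) (ZMod (p ^ cyclotomicExponent p)) b)) *
                (ratMinusSymbol f' ((b.val : ℚ) / ((p ^ (m + 1) : ℕ) : ℚ)) : ℂ_[p]))) :=
    fun m hm θ heven hord hprim ↦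
      hasLineValueAt_twin_of_cycLineInterpolation_odd ι K hp4 hArt h2 κ hκ hκ2 hpd hfE hfV.1
        hfV.coeffField_eq_bot hfV'.1 hfV'.coeffField_eq_bot hE hfV'c hG hm θ heven hord hprim
  -- `T = 0`
  have hm0 : cyclotomicExponent p ≤ 0 + 1 := by rw [he1]
  have h0 : PowerSeries.constantCoeff G =
      c * algebraMap ℚ_[p] ℂ_[p] (PowerSeries.constantCoeff B₁) *
        algebraMap ℚ_[p] ℂ_[p] (PowerSeries.constantCoeff B₂) := by
    have h := hpt 0 hm0 1 (MulChar.one_apply isUnit_one.neg) ⟨0, by rw [orderOf_one, pow_zero]⟩ (Or.inr rfl)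
    rw [twin_one, MulChar.one_apply (isUnit_cyclotomicGenerator_cast p (0 + 1)), sub_self,
      sum_one_mul_teichWeight_mul_ratMinusSymbol_eq hp2 hm0 f,
      sum_one_mul_teichWeight_mul_ratMinusSymbol_eq hp2 hm0 f'] at h
    rw [(h.eq_constantCoeff).symm, hB₁, hB₂,
      constantCoeff_padicLFunctionMinusBranchMult_half_of_mult hp2 V hV hfV,
      constantCoeff_padicLFunctionMinusBranchMult_half_of_mult hp2 V' hV' hfV', hα', zero_add, pow_one,
      map_mul, map_mul]
  -- the characters of `Γ`
  have hchar : ∀ (m : ℕ) (χ : DirichletCharacter ℂ_[p] (p ^ (m + 2))), χ.IsPrimitive → χ.Even →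
      (∃ j : ℕ, orderOf χ = p ^ j) → ∀ v₁ v₂ : ℂ_[p],
        HasSum (fun i ↦ algebraMap ℚ_[p] ℂ_[p] (PowerSeries.coeff i B₁) *
          (χ (cyclotomicGenerator p : ZMod (p ^ (m + 2))) - 1) ^ i) v₁ →
        HasSum (fun i ↦ algebraMap ℚ_[p] ℂ_[p] (PowerSeries.coeff i B₂) *
          (χ (cyclotomicGenerator p : ZMod (p ^ (m + 2))) - 1) ^ i) v₂ →
        HasSum (fun i ↦ PowerSeries.coeff i G *
          (χ (cyclotomicGenerator p : ZMod (p ^ (m + 2))) - 1) ^ i) (c * v₁ * v₂) := by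
    intro m χ hχ heven hord v₁ v₂ hv₁ hv₂
    have hfin : IsOfFinOrder χ := by
      obtain ⟨j, hj⟩ := hord
      exact orderOf_pos_iff.mp (by rw [hj]; exact pow_pos hpP.pos j)
    obtain ⟨θ, hθ⟩ := exists_eq_twin_of_isOfFinOrder ι χ hfin
    subst hθ
    have hθeven : θ.Even := (twin_even_iff ι θ).mp heven
    have hθprim : θ.IsPrimitive := (twin_isPrimitive_iff ι θ).mp hχ
    have hθord : ∃ j : ℕ, orderOf θ = p ^ j := by rwa [orderOf_twin ι θ] at hord
    have hm : cyclotomicExponent p ≤ (m + 1) + 1 := by rw [he1]; omega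
    have hT₁ := hasSum_coeff_padicLFunctionMinusBranchMult_mul_pow_of_mult V hV hfV (p / 2) (m := m + 1)
      hm _ heven hord
    have hT₂ := hasSum_coeff_padicLFunctionMinusBranchMult_mul_pow_of_mult V' hV' hfV' (p / 2) (m := m + 1)
      hm _ heven hord
    have e₁ := hv₁.unique hT₁
    have e₂ := hv₂.unique hT₂
    have h := hpt (m + 1) hm θ hθeven hθord (Or.inl hθprim)
    rw [e₁, e₂, hα']
    exact h
  have hmain := coeff_one_eq_of_forall_hasSum_of_bounded hCG hM₁ hM₂ c h0 hchar hB0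
  rw [hmain, hB₂]

end LeadingCoeffOdd

end Summit.BirchSwinnertonDyer.BirchSwinnertonDyer.Theorems.AdditiveBranchIMCMultLower

end
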